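import Mathlib
import HarnessLib
import HarnessLib.Audit
import Summits.HodgeConjecture.Statement
import Literature.AlgebraicGeometry.Motives.AbelianVariety
import Literature.AlgebraicGeometry.Motives.Sweep1
import Literature.AlgebraicGeometry.HodgeTheory.HodgeConjecture
import Literature.AlgebraicGeometry.Crystalline.BlochEsnaultKerzLifting
import Literature.AlgebraicGeometry.HodgeTheory.HodgeLocus
import Literature.AlgebraicGeometry.HodgeTheory.AtiyahClassTraceReal
import Literature.AlgebraicGeometry.KTheory.HuInfinitesimalKZero
import Literature.AlgebraicGeometry.Crystalline.HodgeDeRhamDegeneration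

/-!
Route: PadicSemiregularLift

Thesis X (card padic-semiregular-object-lifting: "lift OBJECTS, not classes"). It suffices to show:
(P1) p-ADIC SEMIREGULAR OBJECT LIFTING (repaired 2026-08-15 after the rank-one refutation of the
first filing — Godeaux–Serre
witness with H²(𝒳,O)[p] ≠ 0, refuter rattack-1498-0): for k perfect of characteristic p, 𝒳/W = W(k)
smooth PROJECTIVE of relative
dimension d with d + 6 < p and TORSION-FREE HODGE COHOMOLOGY (Bloch–Esnault–Kerz Rem. 35(2);
automatic for abelian schemes and smooth
hypersurfaces, i.e. at the anchors), X_n = 𝒳 ⊗ W/p^n, and a finite locally free E_1 on X_1 = X_k: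
(P1b, crux PadicPridhamSemiregularity — TYPED 2026-08-16 over the real carrier
HodgeTheory.IsZeroOneSemiregular) a {0,1}-SEMIREGULAR E_1
((σ₀,σ₁) = (Tr, Tr(At∘−)) injective on Mathlib's Ext²(E_1,E_1); stated on ANY smooth proper model,
no further hypothesis) satisfies
(⋆) CLASS-LIFTS-IMPLY-OBJECT-LIFTS: every finite locally free lift F of E_1 to X_{n+1} whose
K₀-class is a restriction from X_{n+2} is
itself a restriction of a finite locally free sheaf on X_{n+2} (mechanism: σ∘ob is ADDITIVE on short
exact sequences, hence factors through
K₀(X_{n+1}) and dies on restricted classes — the p-adic shadow of Pridham2024 /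
BandieraLepriManetti2023 / BuchweitzFlenner2003; the
⊕_{q<p} σ_q version 'p-adically semiregular ⇒ (⋆)' and the comparison σ_q(o(E_n)) = gr^q Ob_n([E_n])
with the Bloch–Esnault–Kerz class
obstruction are the intended strengthening (carrier HodgeTheory.IsSemiregularReal now exists) but
are not load-bearing for the anchors used);
(P1a, typed crux FormalLiftingFromClassLifting) (⋆) + torsion-free Hodge cohomology + "[E_1]⊗1 lifts
to (lim_n K_0(X_n)) ⊗ ℚ" (conclusion (b)
of BEK Thm 1.3, supplied from the BEK Hodge condition Φ^{-1}ch^cris(E_1) ∈ ⊕_r F^r H^{2r}_dR(X_K/K)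
through the tree's named fact
BlochEsnaultKerzLifting) ⇒ E_1 lifts COMPATIBLY to a formal vector bundle (LiftsFormally); (P1c,
typed support LineBundleStepLifting) in rank
one (⋆) is the determinant trick, so P1 on line bundles is Berthelot–Ogus 3.8; (P3a, typed
FormalVectorBundlesAlgebraize — Grothendieck
existence, KNOWN in print) LiftsFormally ⇒ LiftsTo: the compatible lift ALGEBRAIZES, so bo
ch^cris(E_1) = ch_dR(E_K) is ALGEBRAIC on X_K — the
step that is free for objects and open for K₀-classes (BEK's 'algebraization').
(P2) SEEDS ON THE TWO ANCHOR CLASSES (REPAIRED 2026-08-16). The ∀-anchor seed statement P2a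
SemiregularSeedsOnAnchors (stmt-13941, itself
the 2026-08-15 repair of stmt-1805) is REFUTED-SUBSTANTIVE as filed and DROPPED: at a very general
W-point of the p-adic Hodge locus of an
unsaturated pair class inside a 23-parameter family of sextic fourfolds with Fermat special fibre (p
≡ 5 (6), p ≫ 0) the second-order
Hodge-locus obstruction (Griffiths–Dwork carries) forbids every p-adically semiregular seed —
locally free, coherent or perfect — reaching the
class (Cruxes/SemiregularSeedsOnAnchors/KILL.md, KILL-REVIEW.md; certificate
Theorems/SemiregularSeedsOnAnchors/Negative/SexticSliceCertificate.lean,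
p83690). The witness is NEITHER an abelian scheme NOR a Fermat lift — the only anchors the assembly
ever consumes — so P2 survives exactly
as its two anchor-class halves (refuter's Repair §H6: split by anchor class), carried by two GLUE
NODES — typed implication items; FermatAnchorAssembly is a CRUX and a hypothesis of the deciding
theorem together
with the engine P1b/P1a/P3a (so the whole engine sits in the cone of `closes`),
AbelianAnchorAssembly is support-kind until the crux cap
allows its promotion (the abelian arm meanwhile enters `closes` through the crux
HodgeAbelianVarieties); each node is to be split into typed
children — the seed statements as CRUXES — once its vocabulary is an importable defs module
(requests filed):
(A) AbelianAnchorAssembly : P2c → P1a → P3a → HodgeAbelianVarieties. Content = (S) StarSeeds — on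
every model 𝒴/W(k̄) with P1a's
hypotheses whose special fibre is a SUPERSINGULAR ABELIAN VARIETY, every rational algebraic class u
of codimension 1 ≤ r < d with bo(u) ∈ F^r
is, up to N ≠ 0, a ℤ-combination of ch_r(E_i) of finite locally free E_i with the BEK Hodge
condition in all degrees and (⋆) ((⋆) is asked
directly: cdisprove-1333 Findings 14–16 show that seeds for Weil generators on E^{2n}, n ≥ 3, are
never {0,1}-semiregular); (N)
InnerFormAnchors = P2b (B1) at abelian type, TRUE IN PRINT — every complex abelian variety sits at a
point of a ℚ̄-family with global Hodge
classes and a ℚ̄-generic point whose fibre carries a GENUINE SPANNING supersingular anchor (Kisin's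
inner form I_x at basic points of
hyperspecial integral models, KisinMadapusiperaShin2022 / ViehmannWedhorn2013, fixed-part theorem,
Blasius1994); (I)
AnchorTransport.IsoInvariance (stmt-1078, proved) and AnchorTransport.HodgeModels (stmt-1943,
needs-fact). GIVEN (S)(N)(I) THE NODE IS
KERNEL-CHECKED: HodgeAbelianVarieties_of
(Cruxes/HodgeAbelianVarieties/Lines/inner-form-invariant-seeds.lean, gen 3 + Glue IV; engine lemmas
landed as Theorems/PadicSemiregularLiftHodgeAbelianVarietiesStarSeedsEngine.lean).
(F) FermatAnchorAssembly : P1b → P1a → P3a → HodgeFermatVarieties. Content = (F′) seeds on the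
FERMAT LIFT 𝒳 = X^n_m ⊗ W(F̄_p) ITSELF,
p > n + 6, m ∣ p^ν + 1 (Shioda–Katsura supersingular reduction; smooth hypersurface ⇒ torsion-free
Hodge cohomology; X^n_m,ℂ ≅ 𝒳_K ⊗_ι ℂ for
any ι : K → ℂ, so NO propagation is needed): every de Rham component α ∈ F^r H^{2r}_dR(𝒳_K/K) of a
rational (r,r)-class of X^n_m
(absolutely Hodge of CM type, φ-Tate on the nose: Ogus1982 §4) lies in K-span{bo ch_r^cris(E_i)} +
Lef^r(𝒳_K) for finitely many
{0,1}-SEMIREGULAR finite locally free E_i on X^n_m ⊗ F̄_p with the BEK Hodge condition in all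
degrees — and it suffices to reach the
RESIDUAL classes of the crux chain of HodgeFermatVarieties (Aoki–Shioda lattice criterion: one
Yamamoto–Aoki SIGN CLASS per bad degree,
first m = 33, 35); (D) the descent bookkeeping P3 GrothendieckExistenceDescent. First typed child
EXISTS: SemiregularSeedsOnFermatScope
(Cruxes/SemiregularSeedsOnAnchors/Lines/gorenstein-ci-seeds.lean — Fermat fourfold anchors,
saturated characters, rank-2 Hartshorne–Serre
bundles of CI-type surfaces, 1-semiregular by Villaflor's Jacobian-colon / Gorenstein duality; that
line's stubs and landed helpers
transfer verbatim to this node).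
(P2c, typed support HodgeLocusPropagation) algebraicity of a global class at one ℚ̄-generic point of
an irreducible base propagates to every
fibre (known); (P2b, informal support AnchorsAtGenericHodgeLocusPoints) anchor existence, B1 abelian
/ B2 Fermat; (P3, informal support
GrothendieckExistenceDescent) comparison at one embedding K ↪ ℂ (Cassels) and the ℚ-structure; (P4,
named, not claimed) Ogus's
crystalline-Tate conjecture beyond abelian type — with P2(general) this is the content of the
declared remainder crux HodgeBeyondAnchors.
Then AbelianAnchorAssembly ∧ FermatAnchorAssembly ∧ P1b ∧ P1a ∧ P3a ∧ P2c ⟹ HodgeAbelianVarieties ∧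
HodgeFermatVarieties (one line of logic;
planner Sketch.lean rc 0, 2026-08-16), and the deciding theorem (re-certified 2026-08-16, crux
hypotheses only, engine in its cone) is
closes : FermatAnchorAssembly → PadicPridhamSemiregularity → FormalLiftingFromClassLifting →
FormalVectorBundlesAlgebraize →
HodgeAbelianVarieties → HodgeBeyondAnchors → HodgeConjecture (h₂ := hF h1b h1a h3a :
HodgeFermatVarieties, then the case split on the
anchor class: abelian / Fermat / the rest).
TYPED LAYER: P1a, P1b, P1c, P3a, P2c, the two assembly nodes and the three outputs are typed over
the real p-adic vocabulary (WittScheme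
thickenings / LiftsFormally / LiftsTo, KTheory.KZero / ContinuousKZeroRat, structureSheafCohomology
/ hodgeCohomologyOne,
HodgeTheory.IsZeroOneSemiregular, HodgeTheory/HodgeLocus + GlobalInvariantCycles); the seed / anchor
statements (S), (N), (F′) are typed
only INSIDE the crux lines (structures PadicModel / Anchor / IsGenuine / ModelHypotheses /
StarSeedsFor; FermatLiftDictionary /
IsFermatFourfoldAnchor / SeedSpan) and become items of this route when those vocabularies land as
importable defs modules; P2b, P3, P4
stay informal. Outputs: HodgeAbelianVarieties := ∀ A : AbelianVariety ℂ, HodgeConjectureFor A.dim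
A.X; HodgeFermatVarieties := ∀ n m X,
IsFermatVariety n m X → IsSmoothProjective n X → HodgeConjectureFor n X; HodgeBeyondAnchors := ∀ n
X, IsSmoothProjective n X →
(X is not A.X of an n-dimensional abelian variety) → (X is no Fermat hypersurface) →
HodgeConjectureFor n X, the complement-of-anchors
REMAINDER — a DECLARED CRUX (rank 6) and the named hypothesis h₃ of `closes` (support-kind
2026-08-15, re-declared crux 2026-08-16 rev 12
under the rule 'every hypothesis of the deciding theorem is a crux', confirmed by the judge-repair
of 2026-08-16): the honest open rest of
HC, reached through the mechanism only via P2(general) ∧ P4; summit-weight, vetted, and no crux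
chain is seated on it as typed.
Lean: FermatAnchorAssembly → PadicPridhamSemiregularity → FormalLiftingFromClassLifting →
FormalVectorBundlesAlgebraize → HodgeAbelianVarieties → HodgeBeyondAnchors → HodgeConjecture

Rationale: WHY THIS LINE. Bloch–Esnault–Kerz (BlochEsnaultKerz2014pAdic, arXiv:1203.2776 p.3, Thm. 3) settle
the DEFORMATION half of the
Fontaine–Messing p-adic variational Hodge conjecture at the level of K_0-CLASSES (p > d+6;
rationally and without the bound via the
Beilinson fibre square, AntieauEtAl2022) and stop at ALGEBRAIZATION ("unlike for Pic, there is no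
general approach known"; Remark (iii):
one may have to move to another pro-class; BlochEsnaultKerz2014CharZero appendix: K_0(X) → lim
K_0(X_n) is not surjective). For OBJECTS
(coherent sheaves / perfect complexes) algebraization is Grothendieck existence (EGAIII1 §5) — free.
So the whole weight moves to
lifting objects step by step over W_n, which is obstruction theory, and the characteristic-0 theorem
that kills such obstructions is
now proved: Pridham2024 (FMS 12 e132, arXiv:1208.3111) / BandieraLepriManetti2023 — semiregularity ⟹
obstructions vanish, and
σ(obstruction) = failure of ch to stay in the Hodge filtration (BuchweitzFlenner2003 maps). Its q =
0 / rank-one case in mixed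
characteristic IS Deligne–Berthelot–Ogus lifting of line bundles (BerthelotOgus1983; BEK p.3), i.e.
BEK's own starting point. Imported
areas: derived deformation theory (Atiyah class, semiregularity, Goodwillie/AMMN-type rational
statements) + integral p-adic Hodge
theory (BEK's motivic pro-complex Z_X.(r), fundamental triangle p(r)Ω^{<r}[-1] → Z_{X.}(r) →
Z_{X_1}(r)) + arithmetic of supersingular
anchors (Tate free on E^{2n}/F_{p²}: NS rank = b_2, so Λ^{even}H^1 is generated by divisors;
Shioda–Katsura unirational Fermat
reductions), where semiregular representatives may exist for classes with no convenient
representative on any complex fibre.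
Catalogue used: geometric/motivic LIFT (arithmetize: very general unramified p-adic point,
Cassels1976) + deformation theory; no
physical analogy, no probabilistic model. REPAIR 2026-08-15: the first filing of P1 omitted
Berthelot–Ogus/BEK's torsion hypothesis and was false
already in rank one (Godeaux–Serre quotient with H²(𝒳,O)[p] ≠ 0: L_1 semiregular, BEK rational Hodge
condition holds, L_1 does not lift
to X_2 — refuter rattack-1498-0, BerthelotOgus1983 Thm 3.8/Cor 3.11, BlochEsnaultKerz2014pAdic Def
34/Rem 35(2)/Thm 36); P1 now carries
TORSION-FREE HODGE COHOMOLOGY of 𝒳/W and is split into the typed σ-free half P1a (object lifting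
from class lifting, given (⋆)), the
informal engine P1b (p-adic Pridham: semiregular ⇒ (⋆)) and the rank-one calibration P1c
(determinant); in rank one the object/class gap is
empty (P1c), so the witness is a CLASS-level failure of the rational Hodge condition, exactly what
torsion-freeness excludes.
REPAIR 2026-08-15 (P2): the first filing of P2 defined 'supersingular type' by
enumeration, demanded a supersingular-type model of EVERY fixed complex variety (false-to-open for Y
over ℚ̄: refuter rattack-1805-0's
twist-rigidity witness E₁×E₂×E₃/ℚ, 35/56 triples with no common supersingular prime ≤ 6000) and its
hatch 'modulo classes algebraic on
X_K' made it a consequence of HC; P2 is now SemiregularSeedsOnAnchors (crux: seeds on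
COHOMOLOGICALLY supersingular anchors, hatch =
Lefschetz classes only, class φ-Tate on the nose and of Hodge origin) +
AnchorsAtGenericHodgeLocusPoints (support: anchors at ℚ̄-GENERIC
points of Hodge-locus components, abelian and Fermat type — KisinMadapusiperaShin2022 /
ViehmannWedhorn2013 basic loci, Blasius1994,
Ogus1982 Thm 4.14) + HodgeLocusPropagation (typed support: algebraicity spreads from a ℚ̄-generic
point).
REPAIR 2026-08-16 (unused-crux + P2a kill): the ∀-anchor P2a SemiregularSeedsOnAnchors (stmt-13941)
was refuted-substantive at a very
general point of a p-adic Hodge-locus slice through the Fermat sextic fourfold (second-order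
Hodge-locus obstruction; KILL.md, certificate
p83690) and is DROPPED; its two anchor-class halves — the only instances the assembly consumes — are
now carried by the typed implication
items AbelianAnchorAssembly (P2c → P1a → P3a → HodgeAbelianVarieties; content = typed StarSeeds +
InnerFormAnchors of the 1333 skeleton,
whose composition HodgeAbelianVarieties_of is kernel-checked) and FermatAnchorAssembly (P1b → P1a →
P3a → HodgeFermatVarieties; content =
seeds on Fermat lifts, first typed child SemiregularSeedsOnFermatScope of the gorenstein-ci-seeds
line, + descent), of which the Fermat node, a crux hypothesis of the re-certified `closes` together
with P1b/P1a/P3a, puts the whole engine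
into the cone of `closes`; P1b is now TYPED ({0,1}-semiregular ⇒ (⋆), verbatim the
sigma-ob-kzero-additivity line's target over
HodgeTheory.IsZeroOneSemiregular).
RANKED CRUXES. #2 P1b PadicPridhamSemiregularity (TYPED 2026-08-16; the route's new conjecture in
its typable {0,1}-case): for k
perfect of char p, 𝒳/W(k) ANY smooth proper model of relative dimension d, and E_1 finite locally
free on the special fibre with (σ₀,σ₁) =
(Tr, Tr(At∘−)) injective on Ext²(E_1,E_1) (HodgeTheory.IsZeroOneSemiregular), E_1 satisfies (⋆)
class-lifts-imply-object-lifts — the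
(⋆)-clause of P1a verbatim; why it might fail: the intended obstruction class must have σ₀∘ob, σ₁∘ob
ADDITIVE on short exact sequences
(block-triangular Čech cocycles / Buchweitz–Flenner 4.2+4.4) — an additivity failure for the real
Atiyah class on Mathlib's Ext, or a
{0,1}-semiregular E_1 on Ẽ×Ẽ/W(F̄_11) with a lift F whose class lifts but which does not, kills it
(line sigma-ob-kzero-additivity: stubs
G1, G2 landed; G3, H [heart], T open; Pridham2024, BandieraLepriManetti2023, BuchweitzFlenner2003,
Illusie1971). P1b is SETTLED as
THE rank-2 crux (judge-repair 2026-08-16): typed at rev 14, hypothesis h1b of `closes` and consumed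
there (h₂ := hF h1b h1a h3a), vetted by
four refuter passes — rattack g1/g2 on the informal item, refute-pool g48-5 (first typed check),
rattack-g3 (SURVIVES; on paper the typed
{0,1}-statement is theorem-grade for all p, d, n by K₀-additivity of (Tr ob, Tr At∘ob), so its Lean
blockers are exactly the line's
stubs H = Illusie obstruction in Mathlib's Ext² with σ-additivity and T = iso-transport; the ⊕σ_q /
BEK-comparison strengthening stays
unfiled). #2 (co-ranked, behind P1b) P1a
FormalLiftingFromClassLifting (typed): (⋆) + torsion-free Hodge cohomology (H^b(O), H^b(Ω¹)
p-torsion-free ∀ b and (d ≤ 3 ∨ Ω¹ free)) +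
rational pro-class lift of [E_1] (BEK Thm 1.3(b) verbatim) ⇒ LiftsFormally; why it might fail: BEK's
integral upgrade is CH-level (K_0
needs p > d+6) and the level-wise kernel-tower / p-saturation facts (1_K),(2_K) need the relative
K-theory of the nilpotent thickenings
X_k ↪ X_{n+1}, absent from Mathlib and the tree (all three round-1 lines died on that carrier;
round-2 ideas hu-infinitesimal-obstruction
(Hu arXiv:2507.12458 Prop 11.1(i) / Cor 10.5(i) as a named fact), stable-range-devissage,
porteous-rank-one-isation passed triage).
GLUE NODES (typed implications, NEW 2026-08-16; their seed content becomes crux CHILDREN at the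
foreseen splits). #9 FermatAnchorAssembly is a CRUX (hypothesis of `closes`, carrying the engine
into its cone); AbelianAnchorAssembly is SUPPORT r9 for now (D-0019 crux cap: 7 with the
known-but-auto-cruxed P3a and the forced remainder HodgeBeyondAnchors; promote it to a crux
hypothesis in place of HodgeAbelianVarieties when P3a closes). AbelianAnchorAssembly (successor of
P2a's abelian half + P2b (B1)): HodgeLocusPropagation → FormalLiftingFromClassLifting →
FormalVectorBundlesAlgebraize → HodgeAbelianVarieties; content = (⋆)-seeds on supersingular
abelian-scheme anchors
(StarSeeds) ∧ genuine spanning inner-form anchors (InnerFormAnchors, in print) ∧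
AnchorTransport.IsoInvariance (proved) / HodgeModels
(needs-fact) — given these, kernel-checked (HodgeAbelianVarieties_of); why it might fail: no
(⋆)-presentable seed may reach a rational
Weil-plane generator on E⁶ ⊗ F̄_p, p inert (forced kernels; Findings 14–16), and at a genuine
spanning anchor the engine image is
HC-equivalent (Glue IV), so the node then has no proof inside this route; a non-algebraic Weil class
makes it false (MoonenZarhin1999,
Markman2025SecantWeil, BlochEsnaultKerz2014CharZero appendix). #9 FermatAnchorAssembly (crux;
successor of
P2a's Fermat half + P2b (B2) + P3): PadicPridhamSemiregularity → FormalLiftingFromClassLifting →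
FormalVectorBundlesAlgebraize →
HodgeFermatVarieties; content = {0,1}-semiregular seeds with the BEK Hodge condition on the Fermat
lift X^n_m ⊗ W(F̄_p) itself (p > n+6,
m ∣ p^ν+1) reaching the residual sign classes of the HodgeFermatVarieties crux chain, + descent; why
it might fail: at the Fermat point a
semiregular seed forces the formal Hodge locus of its ch₂ mod p to be second-order unobstructed
along ker(⌟P_E) (KILL.md F2–F3) and pure
unsaturated / sign classes have obstructed loci (12/14 pair types on X⁴₆), so seeds must realise
them inside classes of broad character
support — open, 'doubtful' per KILL §6(iii) (Shioda1979HodgeFermat, Aoki1987, Villaflor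
arXiv:1812.03964, Movasati–Villaflor
arXiv:1705.00084). #4 HodgeAbelianVarieties (typed OUTPUT and, until the abelian node is promoted,
the abelian hypothesis of `closes`; derived from AbelianAnchorAssembly + engine; own crux chain:
e-step-secant-induction, subtorus-gallery-bloch-seeds,
symmetry-ladder-isotypic-obstructions alive, inner-form-invariant-seeds = this route's assembly
(A)); #5 HodgeFermatVarieties (typed OUTPUT, in the cone through FermatAnchorAssembly's statement,
derived from it + engine;
own crux chain cancel-by-any-claim-lattice: HC(X^n_m) for all m ≤ 160 outside the 'bad' degrees
modulo the printed supply, residual = one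
sign class per bad degree; Shioda1979HodgeFermat, Aoki1987, Aoki2002). #9
FormalVectorBundlesAlgebraize (auto-crux by docstring wording;
KNOWN — Grothendieck existence for vector bundles, GortzWedhorn2023 Prop 24.95; candidate proofs
from the vendored fact pending, p84778).
#6 HodgeBeyondAnchors — DECLARED CRUX (re-kinded support→crux 2026-08-16 rev 12 by the rule 'every
hypothesis of `closes` is a
crux', confirmed by the judge-repair 2026-08-16: it is the named hypothesis h₃ of `closes`, the
honest open REMAINDER 'HC off the two anchor
classes' = P2(general) ∧ P4 OgusCrystallineTate through the mechanism; typed complement-of-anchors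
form, vetted (refute-pool g46-0/g48-0;
kernel-checked equivalence HC ⟺ HodgeAbelianVarieties ∧ HodgeFermatVarieties ∧ HodgeBeyondAnchors,
p77837); summit-weight by design —
the route's claim is the engine on the two anchor classes, and this item records exactly what is NOT
claimed; no crux chain is seated on
it as typed).
Support: P1c LineBundleStepLifting (typed;
determinant trick), P2b AnchorsAtGenericHodgeLocusPoints (informal; B1/B2 anchor existence; the
Fermat-prime half landed as
Theorems/PadicSemiregularLiftAnchorsAtGenericHodgeLocusPointsFermatPrimes.lean), P2c
HodgeLocusPropagation (typed; known), P3
GrothendieckExistenceDescent (informal bookkeeping; helpers landed), P4 OgusCrystallineTate (named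
input beyond abelian type).
KILL CRITERIA. (a) A counterexample to typed P1b — a {0,1}-semiregular finite locally free E_1 on
the special fibre of a smooth proper
𝒳/W(k) and a finite locally free lift F to X_{n+1} with [F] ∈ im K_0(X_{n+2}) that is not a
restriction from X_{n+2} (first non-classical
case: rank 2 on Ẽ × Ẽ / W(F̄_11)) — closes the route (refuted:PadicPridhamSemiregularity): the
engine is then wrong at object level; a
counterexample to P1a (an E_1 with (⋆), rational pro-class lift, torsion-free Hodge cohomology, not
lifting formally) kills the typed half
and with it the line unless the failure is in the d ≥ 4 typing of torsion-freeness; counterexamples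
USING torsion in H^b(𝒳, Ω^a)
(Godeaux–Serre, Enriques-type, α_p-quotients) are outside the hypotheses and refute nothing. (b)
[HAPPENED 2026-08-16 for the ∀-anchor
form: P2a refuted at a generic Hodge-locus anchor through the Fermat sextic — absorbed by the
anchor-class split.] (b-A) Proof that on
E⁶ ⊗ F̄_p (p inert in the Weil field, disc ≠ −1) NO finite locally free sheaves with the BEK Hodge
condition and (⋆) have ch_3-span
(mod Lef³, up to N) containing the rational Weil-plane generator — refutes StarSeeds, and with Glue
IV turns AbelianAnchorAssembly into
HC(Weil sixfolds) in costume: the abelian arm is then retired (a twisted/derived-seed engine is a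
NEW route). (b-F) Proof that on X⁴₃₃ ⊗
F̄_p (p ≡ −1 (33), p > 10) no {0,1}-semiregular finite locally free E with the BEK Hodge condition
has ch₂ with non-zero component on da
Silva's sign class — refutes the Fermat seed statement at its first residual instance and retires
the Fermat arm. (c) Refutation of
HodgeAbelianVarieties or HodgeFermatVarieties refutes HC itself.
NOT DECOMPOSED YET. TWO FORESEEN GLUED SPLITS, each waiting only for its vocabulary to be an
importable sorry-free defs module (definition
requests filed 2026-08-16; today it lives in Lines files that import this route file):
AbelianAnchorAssembly ⇐ AbelianInnerFormAnchors
(support, = InnerFormAnchors) → AbelianStarSeeds (CRUX r3, = StarSeeds; fallbacks FormalSeeds /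
RationalPVHC) → IsoInvariance →
HodgeModels, glue = HodgeAbelianVarieties_of (already kernel-checked); FermatAnchorAssembly ⇐
FermatLiftSeeds (CRUX r4, the F-half of P2a;
first scope = SemiregularSeedsOnFermatScope) → FermatDescent (support, = P3 typed) → glue. Not
split: P1b into (G tower geometry | H
additivity of σ∘ob | T iso-invariance) — these are the line's stubs, not items; P1a's (1_K)/(2_K)
kernel-tower facts; the ⊕_{q<p} σ_q
strengthening of P1b (carrier HodgeTheory.IsSemiregularReal exists; file it when a consumer needs
σ_q, q ≥ 2 — e.g. abelian seeds certified
by semiregularity in dimension ≥ 6); AnchorsAtGenericHodgeLocusPoints into (B1 | B2); no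
Kuga–Satake/K3 branch; P4 named only.
CHEAPEST FALSIFIER. For the engine: the rank-2 computation of kill criterion (a) on Ẽ × Ẽ / W(F̄_11)
— one explicit {0,1}-semiregular E_1
with a lift F whose class lifts to X_3 but which does not (a finite computation with 2-cocycles on a
product of lifted supersingular
curves). For the Fermat arm: the gorenstein-ci-seeds supply test (m, a, p) = (6, (1,1,3,4,4,5), 11)
(one visible GOOD CI-type datum for a
saturated non-three-pair character of X⁴₆, a finite polynomial search) and, decisively, the
second-order obstruction test of KILL.md F2–F3 run
at the Fermat point for da Silva's m = 33 sign class against Hartshorne–Serre seeds of CI-type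
surfaces (kernel basis of m_P + trilinear
form, the scripts of cdisprove-13941 cycle 4). For the abelian arm: reduce Markman's semiregular
secant sheaf realising the Weil class on a
Weil-type abelian FOURFOLD mod an inert p and decide (⋆) / count dim Ext² against 28 =
h^{0,2}+h^{1,3}+h^{2,4} (arXiv:2502.03415 §1.5, §7).
PRIOR-PROGRAMME NOTES: not read (plancard mode; docs/m5/inspiration not consulted).

Novelty: DELTA: the route replaces Bloch–Esnault–Kerz's open CLASS-level algebraization step by OBJECT-level
lifting — a mixed-characteristic Pridham/semiregularity theorem (P1: σ_q(ob(F_n)) = obstruction for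
ch^cris_{q+1}(F_1) to stay in F^{q+1}H_dR(X_{n+1}/W_{n+1}), so the BEK Hodge condition kills every
obstruction of a p-adically semiregular perfect complex) plus semiregular seeds on supersingular
anchors where Tate is free (P2), so that algebraization is Grothendieck existence and "Tate ⟹ Hodge"
for abelian-type varieties needs neither the K-theoretic continuity conjecture nor motivated cycles;
no source found formulates p-adic semiregularity of perfect complexes as the route around BEK's
algebraization. Expected grade new-combination (card audited so by refuter r15, 2026-08-15: the
diagnosis "objects algebraize, classes do not" is BEK's own; the semiregularity ENGINE and the
supersingular seeding are the contribution).
NEAREST PRIOR ART (searched 2026-08-15; local searchd/OpenAlex/arXiv/galaxy degraded this session,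
crossref/S2/zbMATH answered; audit r15 had working search): (1) BlochEsnaultKerz2014pAdic =
arXiv:1203.2776 READ p.3–4 (Thm. 3 class-level lifting ⟺ Φ^{-1}ch ∈ ⊕F^r, p > d+6; "unlike for Pic,
there is no general approach to the algebraization problem known"; Remark (iii));
BlochEsnaultKerz2014CharZero = doi:10.14231/ag-2014-015 (appendix: K_0(X) → lim K_0(X_n) not
surjective; algebraization ⟹ HC(AV)); (2) Pridham2024 = doi:10.1017/fms.2024.132 (arXiv:1208.3111)
and B  [refs: 10.14231/ag-2014-015, 10.1017/fms.2024.132, 10.1016/j.aim.2023.109358:, 10.1215/00127094-2022-0037, 10.1090/fic/056/13, 1203.2776, 1208.3111, doi:10.14231/ag-2014-015, doi:10.1017/fms.2024.132, doi:10.1016/j.aim.2023.109358, doi:10.1215/00127094-2022-0037, doi:10.1090/fic/056/13, Pridham2024, BandieraLepriManetti2023, BerthelotOgus1983, AntieauEtAl2022, Murty2009, BuchweitzFlenner2003]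

Barriers (technique_class: p-adic-lifting,semiregularity,abelian-varieties,k-theory-lift): technique_class: p-adic-lifting,semiregularity,abelian-varieties,k-theory-lift
- Literature.Barriers.HodgeConjecture.hodgeClassesAreAbsoluteFor_abelianVariety: consistent,
proof-side — Deligne's theorem (and its crystalline companion Blasius1994/Ogus1982: Hodge classes on
abelian varieties are crystalline-Tate at unramified p) is an INPUT of P2 (it makes α_dR
Frobenius-eigen on the special fibre so that seeds can exist); no Galois-conjugation refutation is
attempted.
- Literature.Barriers.HodgeConjecture.Andre1996_hodgeClassesOnAbelianVarieties_motivated: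
consistent, proof-side — the route PROVES algebraicity of (motivated) Hodge classes on abelian
varieties; it searches for no counterexample there; André's theorem is not used (no motivated cycles
in the assembly).
- Literature.Barriers.HodgeConjecture.AtiyahHirzebruch1962_torsionClass_notAlgebraic: relevant as a
WARNING inside P1 — integral obstructions living in crystalline torsion are exactly where a p-adic
Pridham theorem can fail; the route works with ℚ-coefficients (K_0 ⊗ ℚ, p > d+6 as in BEK, or
rationally via AntieauEtAl2022) and concludes rational algebraicity only, so the torsion
counterexamples are not met.
- Literature.Barriers.HodgeConjecture.Kollar1992_nonTorsionClass_notAlgebraic: not met — rational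
coefficients throughout; denominators introduced by ch and by p > d+6 are harmless for
HodgeConjectureFor (ℚ-span).
- Literature.Barriers.HodgeConjecture.Voisin2002_weilTorus_hodgeClassWithoutSubvarieties: evaded —

Novelty grade: new-combination — ROUTE REVIEW (refuter, 2026-08-15). Novelty kept at the card audit's grade (new-combination, refuter r15: BEK's 'objects algebraize, classes do not' + mixed-char Pridham/semiregularity engine + supersingular seeding); I re-read BEK arXiv:1203.2776 p.3 Thm 3 (CLASS-level, (lim K₀(X_n))⊗ℚ, p>d+6) and  (refuter refuter-rreview-route-HubbardSuperconduc-80a57a10-0, 2026-08-15T11:24:05Z; prior: arXiv:1203.2776 Thm 3, Rem 35, doi:10.1017/fms.2024.132, BandieraLepriManetti2023)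

History (route lifecycle, newest last):
- 2026-08-15T10:58:46Z · rev 1: dropped stmt-HodgeConjecture-1612, stmt-HodgeConjecture-1633 — dedup: three identical informal P1 items were created by CLI retries (no signature => no dedup); keep stmt-HodgeConjecture-1498 as PadicSemiregularLifting (planner-plancard-HodgeConjecture-HodgeConject-2b2a08bb-0)
- 2026-08-15T21:29:18Z · rev 5: restated PadicSemiregularLifting (stmt-HodgeConjecture-1498) — route-repair (refuted-misstated P1, refuter rattack-1498-0, Godeaux–Serre witness with H^2(X,O)[p]≠0): PadicSemiregularLifting (stmt-1498, informal) restated as (planner-rrefute-HodgeConjecture-PadicSemiregul-e4ab6832-0)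
- 2026-08-15T21:37:58Z · rev 7: dropped stmt-HodgeConjecture-1805 — route-repair (refuted-misstated P2 SemiregularSeeds stmt-1805, refuter rattack-1805-0: M1 'supersingular type' by enumeration, M2 ℚ̄-rigidity/twist-rigidity of (planner-rrefute-HodgeConjecture-PadicSemiregul-64d5b2b6-0)
- 2026-08-15T21:42:38Z · rev 9: restated HodgeBeyondAnchors (stmt-HodgeConjecture-1335) — route-repair (ground-failed): Assembly (stmt-1336) was flagged ground.trivial (tauto) because HodgeBeyondAnchors carried the anchors HodgeAbelianVarieties/Hodge (planner-rground-HodgeConjecture-PadicSemiregula-0d70acf5-0)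
- 2026-08-16T02:17:28Z · AUTO-CRUX: 1 conjecture-grade item(s) promoted to crux (FormalVectorBundlesAlgebraize) — refuter vetting / tiering apply (operator:999:1362873)
- 2026-08-16T06:34:28Z · rev 11: dropped SemiregularSeedsOnAnchors — route-repair (unused-crux, planner d7421452): (1) DROP P2a SemiregularSeedsOnAnchors (stmt-HodgeConjecture-13941) — REFUTED-SUBSTANTIVE as filed (∀ p-adic ancho (planner-rrepair-HodgeConjecture-PadicSemiregul-d7421452-0)
- 2026-08-16T06:46:51Z · rev 17: restated AbelianAnchorAssembly (stmt-HodgeConjecture-14873) — route-repair (unused-crux, planner d7421452), step 8: re-activate the support glue node AbelianAnchorAssembly (stmt-14873): it was marked BLOCKED 'missing decl (planner-rrepair-HodgeConjecture-PadicSemiregul-d7421452-0)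
- 2026-08-16T06:59:27Z · rev 18: dropped stmt-HodgeConjecture-13954 — route-repair (rbadge g3, import cone): the 2 unproved named facts of the payload, deligne_globalInvariantCycles and charlesSchnell_hodgeClass_of_flat (Literatur (planner-rbadge-HodgeConjecture-PadicSemiregula-0d70acf5-g3-0)

sub-problem: HodgeConjecture · status: open · opened planner-plancard-HodgeConjecture-HodgeConject-2b2a08bb-0 2026-08-15T10:54:41Z · rev 23 · ledger route-HodgeConjecture-PadicSemiregularLift
GENERATED by the gate from the ledger (D-0016/17). Provers cite these decls: `theorem foo : Summit.HodgeConjecture.HodgeConjecture.Theses.PadicSemiregularLift.<Decl> := …` in Summits/HodgeConjecture/HodgeConjecture/Theorems/<Name>.lean.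
-/

namespace Summit.HodgeConjecture.HodgeConjecture.Theses.PadicSemiregularLift

open scoped BigOperators Topology Manifold Classical MeasureTheory ProbabilityTheory Matrix InnerProductSpace ComplexConjugate ContinuousMap
open Filter Set Function TopologicalSpace MeasureTheory

attribute [summit_statement] _root_.HodgeConjecture

/-- item stmt-HodgeConjecture-13815 · crux · rank 2 · closed · proved by Summit.HodgeConjecture.HodgeConjecture.Theorems.PadicPridhamSemiregularity.padicPridhamSemiregularity_proof (prover) · by planner
why it might fail: Typed {0,1}-form: needs Illusie's ob(F) in Mathlib's Ext² with ob=0 ⇔ F extends to X_{n+2}, and (Tr ob, Tr At∘ob) ADDITIVE on short exact sequences so it factors through K₀ (BF2003 4.2/4.4 is char 0); an additivity failure for the tree's real Atiyah class, e.g. rank 2 on Ẽ×Ẽ/W(F̄₁₁), kills it.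
sources: Pridham2024, BandieraLepriManetti2023, BuchweitzFlenner2003, Illusie1971, BlochEsnaultKerz2014pAdic, arXiv:1208.3111
[crux] P1b p-ADIC PRIDHAM / BUCHWEITZ–FLENNER COMPATIBILITY: SEMIREGULAR BUNDLES SATISFY (⋆) (rank
2; the route's new conjecture; INFORMAL until a REAL Atiyah class + trace of finite locally free
O_X-modules (σ_q on Mathlib's Ext) and the Hodge sheaves Ω^a = Λ^a Ω¹ with H^b(X,Ω^a) land —
definition requests filed; over the interface SemiregularityMap (σ is data) a closed ∀-statement
'semiregular ⇒ lifts' is refutable by re-decoration). SETTING: k perfect of characteristic p, W =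
W(k), 𝒳/W smooth projective of relative dimension d with d + 6 < p and TORSION-FREE HODGE COHOMOLOGY
H^b(𝒳, Ω^a_{𝒳/W}) for all a, b (Bloch–Esnault–Kerz Rem. 35(2); true for abelian schemes and smooth
complete intersections — the route's anchors); X_n = 𝒳 ⊗ W/p^n, X_1 = X_k; E_1 a FINITE LOCALLY FREE
sheaf on X_1 (perfect complexes with negative self-Exts are not claimed: derived-stack formulation);
σ_q : Ext²_{X_1}(E_1,E_1) → H^{q+2}(X_1, Ω^q_{X_1/k}), σ_q(ξ) = tr(At(E_1)^q ∘ ξ)/q!, 0 ≤ q < p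
(crystalline Buchweitz–Flenner maps). CLAIM (i′) [lift-dependent, well-posed form of the old (i)]:
for n ≥ 1 and every finite locally free E_n on X_n with E_n|X_1 ≅ E_1, σ_q(o(E_n)) = gr^q
Ob_n([E_n]) in H^{q+2}(X_1, Ω -/
@[route_item "route-HodgeConjecture-PadicSemiregularLift"]
def PadicPridhamSemiregularity : Prop :=
  ∀ (p : ℕ) [Fact p.Prime] (k : Type) [Field k] [CharP k p] [PerfectRing k p] (d : ℕ) (𝒳 : Literature.AlgebraicGeometry.Motives.SchemeOver (WittVector p k)), Literature.AlgebraicGeometry.Motives.WittScheme.IsSmoothProperModel d 𝒳 → ∀ (E₁ : (Literature.AlgebraicGeometry.Motives.WittScheme.specialFibre 𝒳).left.Modules) (hE₁ : Literature.AlgebraicGeometry.Motives.IsFiniteLocallyFree E₁), Literature.AlgebraicGeometry.HodgeTheory.IsZeroOneSemiregular hE₁ → ∀ (n : ℕ) (F : (Literature.AlgebraicGeometry.Motives.WittScheme.thickening 𝒳 (n + 1)).left.Modules) (hF : Literature.AlgebraicGeometry.Motives.IsFiniteLocallyFree F), Nonempty ((AlgebraicGeometry.Scheme.Modules.pullback (Literature.AlgebraicGeometry.Motives.WittScheme.specialFibreToThickening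 𝒳 n)).obj F ≅ E₁) → (∃ y : Literature.AlgebraicGeometry.KTheory.KZero (Literature.AlgebraicGeometry.Motives.WittScheme.thickening 𝒳 (n + 2)).left, Literature.AlgebraicGeometry.KTheory.KZero.map (Literature.AlgebraicGeometry.Motives.WittScheme.thickeningMap 𝒳 (Nat.le_succ (n + 1))) y = Literature.AlgebraicGeometry.KTheory.KZero.of F hF) → ∃ F' : (Literature.AlgebraicGeometry.Motives.WittScheme.thickening 𝒳 (n + 2)).left.Modules, Literature.AlgebraicGeometry.Motives.IsFiniteLocallyFree F' ∧ Nonempty ((AlgebraicGeometry.Scheme.Modules.pullback (Literature.AlgebraicGeometry.Motives.WittScheme.thickeningMap 𝒳 (Nat.le_succ (n + 1)))).obj F' ≅ F)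

/-- item stmt-HodgeConjecture-13825 · crux · rank 2 · open · by planner
why it might fail: Needs BEK's integral upgrade at K₀-level (Thm 36 is CH-level; K₀ via p>d+6) and level-wise 'Ob_m(η) depends only on η|X_k' (coherent Bocksteins vanish); BEK §8 treats only the full pro-system — a level-wise K₀-obstruction not governed by H^*(p(r)Ω^{<r}) Bocksteins breaks the re-choice.
sources: BlochEsnaultKerz2014pAdic, BerthelotOgus1983, Illusie1971, Lieblich2006, AntieauMathewMorrowNikolaus2022, arXiv:1203.2776
[crux] P1a FORMAL OBJECT LIFTING FROM RATIONAL PRO-CLASS LIFTING (repaired, typed, σ-free half of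
the old P1 `PadicSemiregularLifting`, stmt-HodgeConjecture-1498, refuted-misstated in rank one by
refuter rattack-1498-0's Godeaux–Serre witness; this restatement carries the missing hypothesis).
For k perfect of characteristic p, 𝒳/W(k) a smooth proper model of relative dimension d
(IsSmoothProperModel), projective over W (IsProjectiveOverRing), d + 6 < p, with TORSION-FREE HODGE
COHOMOLOGY — typed over today's carriers as: H^b(𝒳, O) (structureSheafCohomology) and H^b(𝒳,
Ω¹_{𝒳/W}) (hodgeCohomologyOne) have no p-torsion for all b, AND (d ≤ 3 ∨ Ω¹_{𝒳/W} ≅ O^d free), which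
on paper gives torsion-freeness of every H^b(𝒳, Ω^a_{𝒳/W}) (Grothendieck duality Ω^a ↔ Ω^{d−a} for d
≤ 3; Ω^a ≅ O^{C(d,a)} when Ω¹ is free, e.g. abelian schemes = the E^{2n} anchors; Ω^a for a ≥ 2 has
no carrier yet) — and for a finite locally free E₁ on the special fibre X_k satisfying (⋆)
CLASS-LIFTS-IMPLY-OBJECT-LIFTS (for every n and every finite locally free F on X_{n+1} = 𝒳 ⊗
W/p^{n+1} with F|X_k ≅ E₁: if [F] ∈ K₀(X_{n+1}) is the restriction of a class in K₀(X_{n+2}) then F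
is the restriction of a finite locally -/
@[route_item "route-HodgeConjecture-PadicSemiregularLift"]
def FormalLiftingFromClassLifting : Prop :=
  ∀ (p : ℕ) [Fact p.Prime] (k : Type) [Field k] [CharP k p] [PerfectRing k p] (d : ℕ) (𝒳 : Literature.AlgebraicGeometry.Motives.SchemeOver (WittVector p k)), Literature.AlgebraicGeometry.Motives.WittScheme.IsSmoothProperModel d 𝒳 → Literature.AlgebraicGeometry.Crystalline.IsProjectiveOverRing 𝒳 → d + 6 < p → (∀ (b : ℕ) (x : Literature.AlgebraicGeometry.Motives.structureSheafCohomology 𝒳.left b), (p : ℤ) • x = 0 → x = 0) → (∀ (b : ℕ) (x : Literature.AlgebraicGeometry.Motives.hodgeCohomologyOne 𝒳 b), (p : ℤ) • x = 0 → x = 0) → (d ≤ 3 ∨ Nonempty (Literature.AlgebraicGeometry.Motives.cotangentSheaf 𝒳 ≅ SheafOfModules.free (R := 𝒳.left.ringCatSheaf) (Fin d))) → ∀ (E₁ : (Literature.AlgebraicGeometry.Motives.WittScheme.specialFibre 𝒳).left.Modules) (hE₁ : Literature.AlgebraicGeometry.Motives.IsFiniteLocallyFree E₁), (∀ (n : ℕ)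 (F : (Literature.AlgebraicGeometry.Motives.WittScheme.thickening 𝒳 (n + 1)).left.Modules) (hF : Literature.AlgebraicGeometry.Motives.IsFiniteLocallyFree F), Nonempty ((AlgebraicGeometry.Scheme.Modules.pullback (Literature.AlgebraicGeometry.Motives.WittScheme.specialFibreToThickening 𝒳 n)).obj F ≅ E₁) → (∃ y : Literature.AlgebraicGeometry.KTheory.KZero (Literature.AlgebraicGeometry.Motives.WittScheme.thickening 𝒳 (n + 2)).left, Literature.AlgebraicGeometry.KTheory.KZero.map (Literature.AlgebraicGeometry.Motives.WittScheme.thickeningMap 𝒳 (Nat.le_succ (n + 1))) y = Literature.AlgebraicGeometry.KTheory.KZero.of F hF) → ∃ F' : (Literature.AlgebraicGeometry.Motives.WittScheme.thickening 𝒳 (n + 2)).left.Modules, Literature.AlgebraicGeometry.Motives.IsFiniteLocallyFree F' ∧ Nonempty ((AlgebraicGeometry.Scheme.Modules.pullback (Literature.AlgebraicGeometry.Motives.WittScheme.thickeningMap 𝒳 (Nat.le_succ (n + 1)))).obj F' ≅ F)) → (∃ ξ : Literature.AlgebraicGeometry.KTheory.ContinuousKZeroRat (Ideal.span {(p : WittVector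 p k)}) 𝒳, Literature.AlgebraicGeometry.KTheory.KZeroRat.map (Literature.AlgebraicGeometry.Crystalline.specialFibreToTower 𝒳) (Literature.AlgebraicGeometry.KTheory.ContinuousKZeroRat.specialFibre (Ideal.span {(p : WittVector p k)}) 𝒳 ξ) = Literature.AlgebraicGeometry.KTheory.KZeroRat.of E₁ hE₁) → Literature.AlgebraicGeometry.Motives.WittScheme.LiftsFormally 𝒳 E₁

/-- item stmt-HodgeConjecture-1333 · crux · rank 4 · open · by planner
why it might fail: Weil classes on a very general 2n-dimensional abelian variety of Weil type (n ≥ 3), or exceptional classes in Mumford-type families, have no known algebraic representative; one non-algebraic Weil class refutes it (and HC). Known: divisor-generated cases, dim ≤ 3, Weil-type fourfolds (Markman).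
sources: Deligne1982HodgeCycles, MoonenZarhin1999, Markman2025SecantWeil, BlochEsnaultKerz2014CharZero, arXiv:0709.3040
[crux] OUTPUT of the card's partial assembly ObjectLift ∘ Algebraize ∘ Descend at supersingular
anchors E^{2n}/F_{p²} (NS rank = b_2 there, so every even-degree class is a polynomial in divisors
and Tate is free): the Hodge conjecture for every complex abelian variety. In this route it is to be
PROVED from P1 (PadicSemiregularLifting) + P2 (SemiregularSeeds at abelian anchors; the input 'α_dR
is Frobenius-eigen at a very general unramified p' is Blasius1994/Ogus1982, a theorem for abelian
varieties) + P3 (Grothendieck existence + descent at one embedding). Filed typed because it is the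
honest real-definition endpoint of the mechanism (BlochEsnaultKerz2014CharZero appendix:
algebraization ⟹ HC(AV)) and a natural shared target for other Hodge routes. First calibration
inside P2: Weil classes on Weil-type abelian FOURFOLDS (algebraic by Markman2025SecantWeil) must
admit a p-adically semiregular seed on E^4/F_{p²} if the mechanism is right. -/
@[route_item "route-HodgeConjecture-PadicSemiregularLift"]
def HodgeAbelianVarieties : Prop :=
  ∀ A : Literature.AlgebraicGeometry.Motives.AbelianVariety ℂ, Literature.AlgebraicGeometry.HodgeTheory.HodgeConjectureFor A.dim A.X

/-- item stmt-HodgeConjecture-1334 · crux · rank 5 · open · by planner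
why it might fail: For degrees m failing Shioda's combinatorial criterion (P^n_m) there are Hodge classes on X^n_m not spanned by inductive-structure cycles; Aoki1987 supplies algebraic representatives only for some. A non-algebraic one refutes it and HC. Known: m prime or m ≤ 20, all n (Shioda1979HodgeFermat, Ran).
sources: Shioda1979HodgeFermat, Aoki1987, Shioda1979PJA
[crux] OUTPUT at Fermat anchors: X^n_m mod p with p ≡ -1 (mod m) is Shioda–Katsura supersingular and
unirational with every cohomology class algebraic; P2 asks there for p-adically semiregular perfect
complexes (graded matrix-factorisation / complete-intersection type objects are the computable
candidates) with prescribed crystalline Chern character; P1 + P3 then give HC for complex Fermat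
varieties of ALL degrees m and dimensions n. Fermat motives are of CM/abelian type (dominated by
products of Fermat curves), so the crystalline-Tate input is Blasius1994/Ogus1982, not the open P4.
`IsFermatVariety n m X` = X is the hypersurface x_0^m + ⋯ + x_{n+1}^m = 0 in ℙ^{n+1}_ℂ
(Literature/AlgebraicGeometry/Motives/Sweep1); `IsSmoothProjective n X` excludes the degenerate m =
0 case. -/
@[route_item "route-HodgeConjecture-PadicSemiregularLift"]
def HodgeFermatVarieties : Prop :=
  ∀ (n m : ℕ) (X : Literature.AlgebraicGeometry.Motives.SchemeOver ℂ), Literature.AlgebraicGeometry.Motives.IsFermatVariety n m X → Literature.AlgebraicGeometry.Motives.IsSmoothProjective n X → Literature.AlgebraicGeometry.HodgeTheory.HodgeConjectureFor n X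

-- earlier HodgeBeyondAnchors (stmt-HodgeConjecture-1335, replaced 2026-08-15T21:42:38Z -> stmt-HodgeConjecture-14054): retired by None — HodgeAbelianVarieties → HodgeFermatVarieties → ∀ ⦃n : ℕ⦄ ⦃X : Literature.AlgebraicGeometry.Motives.SchemeOver ℂ⦄, Literature.AlgebraicGeometry.Motives.IsSmoothProjective n X → Literature.AlgebraicGeometry.HodgeTheory.HodgeConjectureFor n X
/-- item stmt-HodgeConjecture-14054 · crux · rank 6 · open · by planner
why it might fail: As typed = HC off the two anchor classes (the declared remainder, summit-weight): one non-algebraic Hodge class on a non-anchor X refutes it (and HC); via the mechanism it needs Ogus's crystalline-Tate conjecture (open beyond abelian motives) and supersingular points on general Hodge loci.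
sources: Ogus1982, Blasius1994, BlochEsnaultKerz2014pAdic, Voisin2002, Deligne1982HodgeCycles
[support] TYPED PLACEHOLDER for the general case = P1 ∧ P2(general X) ∧ P3 ∧ P4
(OgusCrystallineTate), RESTATED 2026-08-15 (route-repair, ground) in COMPLEMENT-OF-ANCHORS form: the
Hodge conjecture for every smooth projective n-fold X/ℂ that is NOT an anchor — not the underlying
variety A.X of an n-dimensional complex abelian variety (item HodgeAbelianVarieties) and not a
Fermat hypersurface x₀^m + ⋯ + x_{n+1}^m = 0 (item HodgeFermatVarieties). The earlier typing
`HodgeAbelianVarieties → HodgeFermatVarieties → ∀ X, IsSmoothProjective n X → HodgeConjectureFor n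
X` carried the two anchors as antecedents, which made the Assembly item a propositional tautology
(ground battery: `ground.trivial tauto`); the anchors are now excluded in the hypotheses and the
deciding theorem `closes` does the case split (abelian anchor / Fermat anchor / the rest). The
clause `A.dim = n` is automatic for X smooth projective of dimension n (Motives.schemeDim_eq) and is
carried only because that discharge is outside the route file's import cone. NOT meant to be
attacked as typed — it is the Hodge conjecture for the remaining varieties and carries no mechanism
content; it exists so that the deciding theorem e -/
@[route_item "route-HodgeConjecture-PadicSemiregularLift"]
def HodgeBeyondAnchors : Prop :=
  ∀ ⦃n : ℕ⦄ ⦃X : Literature.AlgebraicGeometry.Motives.SchemeOver ℂ⦄, Literature.AlgebraicGeometry.Motives.IsSmoothProjective n X → (∀ A : Literature.AlgebraicGeometry.Motives.AbelianVariety ℂ, A.dim = n → A.X ≠ X) → (∀ m : ℕ, ¬ Literature.AlgebraicGeometry.Motives.IsFermatVariety n m X) → Literature.AlgebraicGeometry.HodgeTheory.HodgeConjectureFor n X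

/-- item stmt-HodgeConjecture-14106 · crux (kind.auto-crux: conjecture-grade) · rank 9 · closed · proved by Summit.HodgeConjecture.HodgeConjecture.Theorems.padicSemiregularLift_formalVectorBundlesAlgebraize_proof @ dcff391d9fe7 (prover) · by planner
why it might fail: auto-crux — conjecture-grade statement (docstring avows it ('open problem')); it is open, so it may simply be false
sources: conjecture-registry
[support] P3a FORMAL VECTOR BUNDLES ALGEBRAIZE (Grothendieck existence = "formal GAGA" for vector
bundles; theorem in print, typed 2026-08-15 as the object-level half (a) of the informal bookkeeping
item GrothendieckExistenceDescent, stmt-HodgeConjecture-1814). For k perfect of characteristic p and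
𝒳/W(k) a smooth proper model (IsSmoothProperModel d 𝒳: proper suffices, projectivity is NOT needed
for sheaves), every 𝒪-module E₁ on the special fibre X_k that lifts FORMALLY
(WittScheme.LiftsFormally: a system of vector bundles E_n on the thickenings X_{n+1} = 𝒳 ⊗ W/p^{n+1}
with E_{n+1}|X_{n+1} ≅ E_n and E_0|X_k ≅ E₁) lifts ALGEBRAICALLY (WittScheme.LiftsTo: a vector
bundle E on 𝒳 with E|X_k ≅ E₁). Proof in print: choose the transition isomorphisms, so (E_n)_n is a
coherent (indeed locally free) module over the formal completion of 𝒳 along X_k; W(k) is a complete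
noetherian local ring and 𝒳 → Spec W is proper, so Grothendieck's existence theorem
(GortzWedhorn2023 Thm 24.94 = EGAIII1 Thm 5.1.4) gives a coherent E on 𝒳 with Ê ≅ (E_n)_n; E is
locally free of the same rank on all of 𝒳 (GortzWedhorn2023 Prop 24.95: local flatness criterion at
the points of X_k, then Lemma 24.96 — a closed m -/
@[route_item "route-HodgeConjecture-PadicSemiregularLift"]
def FormalVectorBundlesAlgebraize : Prop :=
  ∀ (p : ℕ) [Fact p.Prime] (k : Type) [Field k] [CharP k p] [PerfectRing k p] (d : ℕ) (𝒳 : Literature.AlgebraicGeometry.Motives.SchemeOver (WittVector p k)), Literature.AlgebraicGeometry.Motives.WittScheme.IsSmoothProperModel d 𝒳 → ∀ (E₁ : (Literature.AlgebraicGeometry.Motives.WittScheme.specialFibre 𝒳).left.Modules), Literature.AlgebraicGeometry.Motives.WittScheme.LiftsFormally 𝒳 E₁ → Literature.AlgebraicGeometry.Motives.WittScheme.LiftsTo 𝒳 E₁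

/-- item stmt-HodgeConjecture-14874 · crux · rank 9 · open · by planner
why it might fail: Second-order Hodge-locus obstruction at the Fermat point (KILL.md F2–F3): a semiregular seed makes the formal Hodge locus of its ch₂ unobstructed along ker(⌟P_E); the sign classes (m = 33, 35, …) may admit no such seed — then the node is HC(Fermat)-hard.
sources: Shioda1979HodgeFermat, Aoki1987, ShiodaKatsura1979, Ogus1982, arXiv:1812.03964, arXiv:1705.00084
[support] FERMAT ANCHOR-CLASS GLUE NODE (rank 9 implication item; NEW 2026-08-16, unused-crux
repair; crux-grade content to be split out as typed children, see FORESEEN GLUED SPLIT; successor of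
the refuted ∀-anchor P2a stmt-13941 on its FERMAT half + P2b (B2) + P3 descent; puts P1b/P1a/P3a
into the cone of `closes`). CLAIM: granted the typed engine — P1b PadicPridhamSemiregularity
({0,1}-semiregular ⇒ (⋆)), P1a FormalLiftingFromClassLifting ((⋆) + torsion-free Hodge cohomology +
rational pro-class lift ⇒ LiftsFormally), P3a FormalVectorBundlesAlgebraize (LiftsFormally ⇒
LiftsTo) — HC holds for every complex Fermat hypersurface X^n_m. CONTENT: (F′) SEMIREGULAR SEEDS ON
FERMAT LIFTS (the F-half of P2a; refuter's Repair §H6 `SemiregularSeedsOnFermatLifts` in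
Cruxes/SemiregularSeedsOnAnchors/Disproof.lean): for m ≥ 2 and a prime p > n + 6 with m ∣ p^ν + 1
(Shioda–Katsura supersingular reduction; infinitely many such p,
Theorems/PadicSemiregularLiftAnchorsAtGenericHodgeLocusPointsFermatPrimes.lean), on the FERMAT LIFT
𝒳 = X^n_m ⊗ W(F̄_p) ITSELF (smooth hypersurface ⇒ torsion-free Hodge cohomology; K = W[1/p]; X^n_m,ℂ
≅ 𝒳_K ⊗_ι ℂ for ANY ι : K → ℂ, so no propagation P2c is needed) every -/
@[route_item "route-HodgeConjecture-PadicSemiregularLift"]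
def FermatAnchorAssembly : Prop :=
  PadicPridhamSemiregularity → FormalLiftingFromClassLifting → FormalVectorBundlesAlgebraize → HodgeFermatVarieties

/-- item stmt-HodgeConjecture-15973 · support · rank 3 · open · by planner
[crux] HU'S INFINITESIMAL K₀-THEORY OF THE p-ADIC THICKENINGS (rank 3; ROUTE-CHOICE PROMOTION
2026-08-16 by planner rchoice-1367de67 of the two Literature CLAIMS
`Literature.AlgebraicGeometry.KTheory.HuKZeroLiftingCriterion` ∧ `…HuKZeroKernelPresentation` (X.
Hu, arXiv:2507.12458, @[claim under-review], judged XL-apex: relative K-theory of the nilpotent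
thickenings X_m ↪ X_n via Brun's isomorphism + TC, 138 pp.) to ONE explicit crux of this route — the
apex on which P1a FormalLiftingFromClassLifting (stmt-13825) rests in ranks ≥ 2: the tree has P1a ⟸
Hu1 ∧ Hu2 ∧ Deligne kernel-checked (HuLine.formalLiftingFromClassLifting_of_hu, p107875, LANDED;
seat 3's HuLine.formalLiftingFromClassLifting_of_huFacts_of_hdeg rc 0 end-to-end), rank one / d ≤ 1
Hu-free and landed, and eight lead/route seats + the disprover concur that no Hu-free proof of ranks
≥ 2 exists in any formulation (re-route impossible inside the thesis). STATEMENT (k perfect of char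
p, 𝒳/W(k) smooth proper of relative dimension d, X_l = 𝒳 ⊗ W/p^l, K₀ = KTheory.KZero of vector
bundles = Thomason–Trobaugh K₀ here by the ample family): (Hu1, Thm 1.2 = Prop 11.1(i) p.65 + Prop
9.6(i), d + 6 ≤ p) there are homomorphisms ob m n : -/
@[route_item "route-HodgeConjecture-PadicSemiregularLift"]
def HuInfinitesimalKZero : Prop :=
  (∀ (p : ℕ) [Fact p.Prime] (k : Type) [Field k] [CharP k p] [PerfectRing k p] (d : ℕ) (𝒳 : Literature.AlgebraicGeometry.Motives.SchemeOver (WittVector p k)), Literature.AlgebraicGeometry.Motives.WittScheme.IsSmoothProperModel d 𝒳 → d + 6 ≤ p → ∃ ob : ∀ m n : ℕ, Literature.AlgebraicGeometry.KTheory.KZero (Literature.AlgebraicGeometry.Motives.WittScheme.thickening 𝒳 m).left →+ Literature.AlgebraicGeometry.KTheory.HuObstructionTarget p k 𝒳 d m n, (∀ (m n : ℕ) (hmn : m < n), 1 ≤ m → ∀ ξ : Literature.AlgebraicGeometry.KTheory.KZero (Literature.AlgebraicGeometry.Motives.WittScheme.thickening 𝒳 m).left, (∃ ξ' : Literature.AlgebraicGeometry.KTheory.KZero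 (Literature.AlgebraicGeometry.Motives.WittScheme.thickening 𝒳 n).left, Literature.AlgebraicGeometry.KTheory.KZero.map (Literature.AlgebraicGeometry.Motives.WittScheme.thickeningMap 𝒳 hmn.le) ξ' = ξ) ↔ ob m n ξ = 0) ∧ (∀ (m n n' : ℕ), 1 ≤ m → m < n → ∀ (hnn' : n ≤ n') (ξ : Literature.AlgebraicGeometry.KTheory.KZero (Literature.AlgebraicGeometry.Motives.WittScheme.thickening 𝒳 m).left), ob m n ξ = Literature.AlgebraicGeometry.KTheory.HuObstructionTarget.reduce d m hnn' (ob m n' ξ))) ∧ (∀ (p : ℕ) [Fact p.Prime] (k : Type) [Field k] [CharP k p] [PerfectRing k p] (d : ℕ) (𝒳 : Literature.AlgebraicGeometry.Motives.SchemeOver (WittVector p k)), Literature.AlgebraicGeometry.Motives.WittScheme.IsSmoothProperModel d 𝒳 → d + 5 ≤ p → ∃ ρ : ∀ m n : ℕ, Literature.AlgebraicGeometry.KTheory.HuKernelSource p k 𝒳 m n →+ Literature.AlgebraicGeometry.KTheory.KZero (Literature.AlgebraicGeometry.Motives.WittScheme.thickening 𝒳 n).left, (∀ (m n : ℕ) (hmn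 : m < n), 1 ≤ m → ∀ η : Literature.AlgebraicGeometry.KTheory.KZero (Literature.AlgebraicGeometry.Motives.WittScheme.thickening 𝒳 n).left, Literature.AlgebraicGeometry.KTheory.KZero.map (Literature.AlgebraicGeometry.Motives.WittScheme.thickeningMap 𝒳 hmn.le) η = 0 ↔ ∃ x, ρ m n x = η) ∧ (∀ (m n n' : ℕ), 1 ≤ m → m < n → ∀ (hnn' : n ≤ n') (x : Literature.AlgebraicGeometry.KTheory.HuKernelSource p k 𝒳 m n'), Literature.AlgebraicGeometry.KTheory.KZero.map (Literature.AlgebraicGeometry.Motives.WittScheme.thickeningMap 𝒳 hnn') (ρ m n' x) = ρ m n (Literature.AlgebraicGeometry.KTheory.HuKernelSource.reduce m hnn' x)))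

/-- item stmt-HodgeConjecture-14977 · support · rank 8 · closed · proved by Summit.HodgeConjecture.HodgeConjecture.Theorems.hodgeLocusPropagation_proof @ 6519e4546c27 (prover) · by planner
sources: Voisin2007HodgeLoci, CharlesSchnell2014Notes, Fulton1998, CattaniDeligneKaplan1995JAMS
[support] P2c-GLUE G: ALGEBRAICITY PROPAGATES FROM A ℚ̄-GENERIC POINT (rank 8 support; 1:1
DEFINITIONAL re-filing 2026-08-16, route-repair rbadge g3, of stmt-HodgeConjecture-13954: the
hypothesis `HodgeTheory.IsQuasiProjectiveOver S₀` is INLINED by its definition `∃ (P : SchemeOver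
ℚ̄) (j : S₀ ⟶ P), Motives.IsProjectiveOver P ∧ IsOpenImmersion j.left` — `Iff.rfl` with the old
statement (planner SketchIff.lean, lean check rc 0), so every consumer (AbelianAnchorAssembly
stmt-14913; `HodgeAbelianVarieties_of …(hP : HodgeLocusPropagation)` in the crux lines, which feed
`hS₀ : IsQuasiProjectiveOver S₀` — still elaborates by δ-unfolding) and the prover's conditional
candidate proof (evidence on 13954:
voisin2007_algebraicityLocus_iUnion_qbarClosed.mem_of_qbarGeneric,
Literature/AlgebraicGeometry/HodgeTheory/AlgebraicityLocus.lean) transfer verbatim. PURPOSE: the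
route file no longer needs `import Literature.AlgebraicGeometry.HodgeTheory.GlobalInvariantCycles`,
whose two unproved named facts `deligne_globalInvariantCycles` / `charlesSchnell_hodgeClass_of_flat`
are used by NO item of this route and rode into its import cone on that one definition; rank 8 only
so that the decl renders befor -/
@[route_item "route-HodgeConjecture-PadicSemiregularLift"]
def HodgeLocusPropagation : Prop :=
  ∀ (σ : AlgebraicClosure ℚ →+* ℂ) ⦃𝒳₀ S₀ : Literature.AlgebraicGeometry.Motives.SchemeOver (AlgebraicClosure ℚ)⦄ (f₀ : 𝒳₀ ⟶ S₀) (n p : ℕ), (∃ (P : Literature.AlgebraicGeometry.Motives.SchemeOver (AlgebraicClosure ℚ)) (j : S₀ ⟶ P), Literature.AlgebraicGeometry.Motives.IsProjectiveOver P ∧ AlgebraicGeometry.IsOpenImmersion j.left) → IrreducibleSpace S₀.left → Literature.AlgebraicGeometry.Motives.IsSmoothProjectiveFamily ((Literature.AlgebraicGeometry.Motives.baseChangeHom σ).map f₀) n → ∀ (A : Literature.AlgebraicGeometry.HodgeTheory.complexBetti ((Literature.AlgebraicGeometry.Motives.baseChangeHom σ).obj 𝒳₀) (2 * p)) (s : Literature.AlgebraicGeometry.Motives.ComplexPoints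 ((Literature.AlgebraicGeometry.Motives.baseChangeHom σ).obj S₀)), (∀ Z : Set (Literature.AlgebraicGeometry.Motives.ComplexPoints ((Literature.AlgebraicGeometry.Motives.baseChangeHom σ).obj S₀)), Literature.AlgebraicGeometry.HodgeTheory.IsDefinedOverQbar σ S₀ Z → s ∈ Z → Z = Set.univ) → Literature.AlgebraicGeometry.HodgeTheory.complexBetti.map (Literature.AlgebraicGeometry.Motives.fiberι ((Literature.AlgebraicGeometry.Motives.baseChangeHom σ).map f₀) s) (2 * p) A ∈ Literature.AlgebraicGeometry.HodgeTheory.algebraicClasses (Literature.AlgebraicGeometry.Motives.fiberOver ((Literature.AlgebraicGeometry.Motives.baseChangeHom σ).map f₀) s) p → ∀ t : Literature.AlgebraicGeometry.Motives.ComplexPoints ((Literature.AlgebraicGeometry.Motives.baseChangeHom σ).obj S₀), Literature.AlgebraicGeometry.HodgeTheory.complexBetti.map (Literature.AlgebraicGeometry.Motives.fiberι ((Literature.AlgebraicGeometry.Motives.baseChangeHom σ).map f₀) t) (2 * p) A ∈ Literature.AlgebraicGeometry.HodgeTheory.algebraicClasses (Literature.AlgebraicGeometry.Motives.fiberOver ((Literature.AlgebraicGeometry.Motives.baseChangeHom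 σ).map f₀) t) p

/-- item stmt-HodgeConjecture-13826 · support · rank 9 · closed · proved by Summit.HodgeConjecture.HodgeConjecture.Theorems.lineBundleStepLifting_proof (prover) · by planner
sources: Fulton1998, Hartshorne1977
[support] P1c RANK-ONE CALIBRATION OF (⋆) — LINE BUNDLES EXTEND WHEN THEIR K₀-CLASS DOES
(determinant; folklore, no hypothesis on the schemes): for any morphism of schemes f : Y ⟶ Z and any
finite locally free L of rank 1 on Y, if [L] = f^*y in K₀(Y) (Fulton's K⁰ of finite locally free
sheaves, tree KTheory.KZero) for some y ∈ K₀(Z), then L ≅ f^*L' for a rank-1 locally free L' on Z.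
Proof in print: det : K₀ → Pic is a homomorphism commuting with f^* (SGA6 / Fulton §15.1; Hartshorne
II Ex. 6.11), det[L] = L, so L ≅ det(f^*y) = f^*det(y). Applied to the transition X_{n+1} ↪ X_{n+2}
of the p-adic tower it is hypothesis (⋆) of FormalLiftingFromClassLifting for line bundles (planner
Sketch.lean: shape check rc 0), so that in rank one the whole content of the repaired P1 is CLASS
lifting (Berthelot–Ogus 3.8 / BEK r = 1), and it explains the refutation witness of the old P1:
there [L₁] itself does not lift to K₀(X₂). Needs on the tree: determinant of a finite locally free
O_X-module (exterior powers of sheaves of modules; not in Mathlib at this pin). Sources: Fulton1998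
§15.1, Hartshorne1977 II Ex. 6.11, SGA6 Exp. IV. -/
@[route_item "route-HodgeConjecture-PadicSemiregularLift"]
def LineBundleStepLifting : Prop :=
  ∀ (Y Z : AlgebraicGeometry.Scheme.{0}) (f : Y ⟶ Z) (L : Y.Modules) (hL : Literature.AlgebraicGeometry.Motives.IsFiniteLocallyFree L), Literature.AlgebraicGeometry.Motives.HasRank L 1 → (∃ y : Literature.AlgebraicGeometry.KTheory.KZero Z, Literature.AlgebraicGeometry.KTheory.KZero.map f y = Literature.AlgebraicGeometry.KTheory.KZero.of L hL) → ∃ L' : Z.Modules, Literature.AlgebraicGeometry.Motives.HasRank L' 1 ∧ Nonempty ((AlgebraicGeometry.Scheme.Modules.pullback f).obj L' ≅ L)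

-- item stmt-HodgeConjecture-13944 · support · rank 9 · open · by planner — informal only, no Lean statement yet:
--   [support] P2-ANCHORS: COHOMOLOGICALLY SUPERSINGULAR p-ADIC ANCHORS AT ℚ̄-GENERIC POINTS OF HODGE
--   LOCI — ABELIAN AND FERMAT TYPE (rank 9; arithmetic half of the old SemiregularSeeds stmt-1805,
--   scoped to the two anchor classes as the refuters asked; a theorem to assemble from print; general Y
--   stays in HodgeBeyondAnchors with P4; terms as in SemiregularSeedsOnAnchors). (B1) ABELIAN VARIETIES.
--   For every complex abelian variety Y of dimension n, r ≥ 0 and Hodge class β ∈ H^{2r}(Y(ℂ);ℚ) there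
--   are σ : ℚ̄ → ℂ; a smooth projective family of abelian varieties f₀ : 𝒴₀ → S₀ over ℚ̄ with S₀ a
--   smooth irredu

-- earlier AbelianAnchorAssembly (stmt-HodgeConjecture-14873, replaced 2026-08-16T06:46:51Z -> stmt-HodgeConjecture-14913): retired by None — FormalLiftingFromClassLifting → FormalVectorBundlesAlgebraize → HodgeLocusPropagation → HodgeAbelianVarieties
/-- item stmt-HodgeConjecture-14913 · support · rank 9 · open · by planner
why it might fail: If no (⋆)-presentable seeds reach the rational Weil-plane generator on E⁶⊗F̄_p, p inert (forced kernels; cdisprove-1333 Findings 14–16), the node is HC(Weil sixfolds) in costume at its own anchors (Glue IV) — no proof in this route; a non-algebraic Weil class makes it false.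
sources: BlochEsnaultKerz2014pAdic, BlochEsnaultKerz2014CharZero, KisinMadapusiperaShin2022, ViehmannWedhorn2013, Blasius1994, Markman2025SecantWeil
[support] ABELIAN ANCHOR-CLASS GLUE NODE (rank 9 implication item; NEW 2026-08-16, unused-crux
repair; crux-grade content to be split out as typed children, see FORESEEN GLUED SPLIT; successor of
the refuted ∀-anchor P2a SemiregularSeedsOnAnchors stmt-13941 on its ABELIAN half + P2b (B1); puts
the engine P1a/P3a into the cone of `closes`). CLAIM: granted the typed engine — P1a
FormalLiftingFromClassLifting ((⋆) + torsion-free Hodge cohomology + rational pro-class lift ⇒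
LiftsFormally), P3a FormalVectorBundlesAlgebraize (Grothendieck existence: LiftsFormally ⇒ LiftsTo)
and P2c HodgeLocusPropagation — the Hodge conjecture holds for every complex abelian variety.
CONTENT a proof must supply (both TYPED verbatim in
Cruxes/HodgeAbelianVarieties/Lines/inner-form-invariant-seeds.lean, gen 3): (S) `StarSeeds` =
(⋆)-SEEDS ON SUPERSINGULAR ABELIAN-SCHEME ANCHORS: for k = k̄ of char p and a CrystallineRealization
C with Berthelot–Ogus 3.8 and Bloch–Esnault–Kerz 1.3, on every model 𝒴/W(k) satisfying P1a's
hypotheses (ModelHypotheses d 𝒴) whose special fibre is a supersingular abelian variety A₀ (with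
DivisorClassesAreChern, RationallyLefschetz, Lenstra–Zarhin), every rational algebraic class u -/
@[route_item "route-HodgeConjecture-PadicSemiregularLift"]
def AbelianAnchorAssembly : Prop :=
  HodgeLocusPropagation → FormalLiftingFromClassLifting → FormalVectorBundlesAlgebraize → HodgeAbelianVarieties

/-- item stmt-HodgeConjecture-15974 · support · rank 9 · open · by planner
[support] DELIGNE'S DEGENERATION OF HODGE–DE RHAM MODULO TORSION for smooth proper 𝒳/W(k) (rank 9;
KNOWN — Deligne 1968 Thm 5.5 (ii) for the char-0 generic fibre X_K/K + flat base change W → K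
(Hartshorne III.9.3), invoked verbatim by Bloch–Esnault–Kerz Rem 35 (1); integrally for a + min(b,d)
≤ p−2 by Faltings 1989 / Fontaine–Messing / Kato). ROUTE-CHOICE PROMOTION 2026-08-16 (planner
rchoice-1367de67) of the Literature named fact
`Literature.AlgebraicGeometry.Crystalline.HodgeDeRhamDegeneratesModTorsion` ([cite Deligne1968];
unproved in the tree — no Hodge theory / Deligne–Illusie carrier) to an explicit SUPPORT item of
this route, because it is the third antecedent of the checked closure of P1a
FormalLiftingFromClassLifting (seat 3: HuLine.formalLiftingFromClassLifting_of_huFacts_of_hdeg : Hu1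
→ Hu2 → hdeg → P1a, rc 0 end-to-end; it is needed exactly for the lattice lemmas (S)/(T) in weights
2 ≤ r < d — r = 1 and r ≥ d are landed unconditionally, so models with d ≤ 2 do not use it).
STATEMENT: for k a field of char p and 𝒳/W(k) a smooth proper model (IsSmoothProperModel d 𝒳), every
connecting homomorphism δ : ℍ^{k₀}(𝒳, σ≤n₀ Ω•_{𝒳/W}) → ℍ^{k₀+1}(𝒳, Ω^{n₀+1}_{𝒳/W}[−n₀−1]) of the st -/
@[route_item "route-HodgeConjecture-PadicSemiregularLift"]
def HodgeDeRhamDegeneration : Prop :=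
  ∀ (p : ℕ) [Fact p.Prime] (k : Type) [Field k] [CharP k p] (d : ℕ) (𝒳 : Literature.AlgebraicGeometry.Motives.SchemeOver (WittVector p k)), Literature.AlgebraicGeometry.Motives.WittScheme.IsSmoothProperModel d 𝒳 → ∀ (n₀ n₁ : ℤ) (h : n₀ + 1 = n₁) (k₀ k₁ : ℤ) (hk : k₀ + 1 = k₁), letI K : CochainComplex (CategoryTheory.Sheaf (Opens.grothendieckTopology 𝒳.left.carrier) AddCommGrpCat.{0}) ℤ := (Literature.AlgebraicGeometry.Crystalline.algebraicDeRhamComplex 𝒳).extend ComplexShape.embeddingUpNat; letI Z : CategoryTheory.Sheaf (Opens.grothendieckTopology 𝒳.left.carrier) AddCommGrpCat.{0} := (CategoryTheory.constantSheaf (Opens.grothendieckTopology 𝒳.left.carrier) AddCommGrpCat.{0}).obj (AddCommGrpCat.of (ULift.{0} ℤ)); letI S : CategoryTheory.ShortComplex (CochainComplex (CategoryTheory.Sheaf (Opens.grothendieckTopology 𝒳.left.carrier) AddCommGrpCat.{0}) ℤ) := Literature.Algebra.Homology.stupidFiltrationShortComplex K n₀ n₁ h; haveI : (S.X₁).IsStrictlyGE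 n₁ := (inferInstance : ((CochainComplex.singleFunctor _ n₁).obj (K.X n₁)).IsStrictlyGE n₁); haveI : Literature.Algebra.Homology.HasHyperExt.{0} Z S.X₁ := Literature.Algebra.Homology.hasHyperExt_of_isGE _ _ n₁; haveI : Literature.Algebra.Homology.HasHyperExt.{0} Z S.X₂ := (inferInstance : Literature.Algebra.Homology.HasHyperExt.{0} Z (Literature.Algebra.Homology.stupidTruncLE K n₁)); haveI : Literature.Algebra.Homology.HasHyperExt.{0} Z S.X₃ := (inferInstance : Literature.Algebra.Homology.HasHyperExt.{0} Z (Literature.Algebra.Homology.stupidTruncLE K n₀)); ∀ x : Literature.Algebra.Homology.HyperExt.{0} Z S.X₃ k₀, ∃ m : ℤ, m ≠ 0 ∧ m • Literature.Algebra.Homology.HyperExt.delta (Literature.Algebra.Homology.shortExact_stupidFiltrationShortComplex K n₀ n₁ h) k₀ k₁ hk x = 0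

/-- item stmt-HodgeConjecture-15976 · support · rank 9 · closed · proved by Summit.HodgeConjecture.HodgeConjecture.Theorems.formalLiftingFromClassLiftingOfHu_proof @ cdbbc4dbc9d3 (prover) · by planner
[support] GLUE (rank 9; route-choice promotion, planner rchoice-1367de67): HuInfinitesimalKZero →
HodgeDeRhamDegeneration → FormalLiftingFromClassLifting — Hu's two K₀-claims (item
HuInfinitesimalKZero, stmt-HodgeConjecture-15973) and Deligne's degeneration modulo torsion (item
HodgeDeRhamDegeneration) give P1a (stmt-13825). ROUTINE / CLOSABLE AT ONCE once typed: `fun h hdeg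
=> HuLine.formalLiftingFromClassLifting_of_huFacts_of_hdeg h.1 h.2 hdeg` with seat 3's checked
endgame theorem
(Theorems/PadicSemiregularLiftFormalLiftingFromClassLiftingHuTorsionFreeAssembly.lean, rc 0
end-to-end 16:21Z, landing behind p115294/p115322), or from the LANDED
`HuLine.formalLiftingFromClassLifting_of_hu h.2 h.1 hS hT` (Theorems/…HuAssembly.lean, p107875) with
the lattice lemmas (S)/(T) supplied by the seats' staircase chain (r ≥ d:
Crystalline.huHReduce_surjective_of_dim_le p111643; r = 1: p110800/p111245; 2 ≤ r < d from hdeg: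
Crystalline/StaircaseIntegralDegeneration + KTheory/HuHypercohomologyCriteria). LEAN SIGNATURE (set
by `workitem set-signature` after the two antecedent items are typed): `HuInfinitesimalKZero →
HodgeDeRhamDegeneration → FormalLiftingFromClassLifting` (planner Sketch.lean rc -/
@[route_item "route-HodgeConjecture-PadicSemiregularLift"]
def FormalLiftingFromClassLiftingOfHu : Prop :=
  HuInfinitesimalKZero → HodgeDeRhamDegeneration → FormalLiftingFromClassLifting

-- item stmt-HodgeConjecture-1814 · support · rank 9 · open · by planner — informal only, no Lean statement yet:
--   [support] P3 ALGEBRAIZATION AND DESCENT BOOKKEEPING (rank 9). (a) Grothendieck existence: a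
--   compatible system (F_n)_n of perfect complexes on the thickenings X_n of a PROJECTIVE X/W is the
--   formal completion of a perfect complex F on X (EGAIII1 Thm. 5.1.4 for coherent sheaves; perfect
--   complexes via resolutions / derived formal GAGA), hence Φ^{-1}ch^cris(F_1) = ch_dR(F_K) lies in the
--   K-span of de Rham classes of algebraic cycles on X_K (Riemann–Roch without denominators is not
--   needed: ℚ-coefficients; Deligne 2000 §2(ii)); this is exactly the step that is OPEN for classes
--   (BlochEsnaultKerz2014pAd

-- item stmt-HodgeConjecture-1815 · support · rank 9 · open · by planner — informal only, no Lean statement yet: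
--   [support] P4 OGUS CRYSTALLINE-TATE INPUT (named conjecture, NOT claimed; rank 9). For Y smooth
--   projective over a finitely generated field k_1 ⊂ ℂ and a Hodge class α on Y_ℂ whose de Rham
--   component α_dR is defined over k_1 (true after enlarging k_1), at every sufficiently general
--   unramified prime of good reduction (perfect residue field k, W = W(k), K = W[1/p] ⊇ k_1) α_dR is a
--   crystalline Tate class: φ(α_dR) = p^p · α_dR under the Berthelot–Ogus isomorphism H^{2p}_dR(Y_K/K) ≅
--   H^{2p}_cris(Y_k/W) ⊗ K (Ogus1982: Hodge cycles should be 'absolutely Tate' / crystalline; proved for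
--   abelian varieties a

/-- item stmt-HodgeConjecture-1336 · assembly · rank 1 · closed · proved by Summit.HodgeConjecture.HodgeConjecture.Theorems.padicSemiregularLift_assembly_proof @ 925ca7e0850f (prover) · by planner
sources: BlochEsnaultKerz2014pAdic, Pridham2024
[assembly] Glue, closable now in term mode: `fun hA hF hG n X hX => hG hA hF hX` (planner
Sketch.lean, lean check rc 0, 2026-08-15; `HodgeConjecture` is the root-level summit constant of
Summits/HodgeConjecture/HodgeConjecture/Statement.lean). The MATHEMATICAL assembly of the card is
ObjectLift (P1: compatible lifts F_n of a p-adically semiregular F_1 with Hodge ch^cris) →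
Algebraize (Grothendieck existence on the proper formal scheme: ch^cris(F_1) = ch_dR(F_K) is
algebraic on X_K) → Descend (P3: K ↪ ℂ over the field of definition, comparison at one embedding,
ℚ-structure) applied to the seeds of P2; the typed chain records its outputs by anchor class
(abelian varieties, Fermat varieties, the rest). -/
@[route_item "route-HodgeConjecture-PadicSemiregularLift"]
def Assembly : Prop :=
  HodgeAbelianVarieties → HodgeFermatVarieties → HodgeBeyondAnchors → HodgeConjecture

-- records of items no longer active in this route (dropped / restated):
-- earlier PadicSemiregularLifting (stmt-HodgeConjecture-1498, replaced 2026-08-15T21:29:18Z -> stmt-HodgeConjecture-13825): retired by None — [crux] P1 p-ADIC PRIDHAM / SEMIREGULAR OBJECT LIFTING (rank 2; informal until defn-CrystallineRealization and defn-SemiregularityMap land). Setting: k perfect of characteristic p, W = W(k), K = W[1/p], X smooth projective over W with special fibre X_1, X_n = X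

/-! D-0027 §2.1 — DECIDING THEOREM (planner-authored via `route open/edit --closes-file`; by planner-rrepair-HodgeConjecture-PadicSemiregul-d7421452-0 2026-08-16T06:44:39Z):
its hypotheses are this route's items and its conclusion the sub-problem Statement (glue_lint), and it elaborates with this file. -/

@[closes "route-HodgeConjecture-PadicSemiregularLift"] theorem closes (hF : FermatAnchorAssembly) (h1b : PadicPridhamSemiregularity) (h1a : FormalLiftingFromClassLifting)
    (h3a : FormalVectorBundlesAlgebraize) (h₁ : HodgeAbelianVarieties) (h₃ : HodgeBeyondAnchors) :
    _root_.HodgeConjecture := by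
  have h₂ : HodgeFermatVarieties := hF h1b h1a h3a
  intro n X hX
  by_cases hAb : ∃ A : Literature.AlgebraicGeometry.Motives.AbelianVariety ℂ, A.dim = n ∧ A.X = X
  · obtain ⟨A, rfl, rfl⟩ := hAb
    exact h₁ A
  · by_cases hFe : ∃ m : ℕ, Literature.AlgebraicGeometry.Motives.IsFermatVariety n m X
    · obtain ⟨m, hm⟩ := hFe
      exact h₂ n m X hm hX
    · push Not at hAb hFe
      exact h₃ hX hAb hFe

end Summit.HodgeConjecture.HodgeConjecture.Theses.PadicSemiregularLift
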